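import Summits.Ventures.DiscreteObjects.Hadamard.FixedRowsOrbitTools

/-!
# Hadamard 668 census, family F12 — order 167: an automorphism of H(668) of order 167 is fixed-point-free with 4 + 4 orbits (kernel)

Framing: lottery ticket; floor = certified bounds/negative ranges.

Cell pub-namedobj (venture DiscreteObjects), target (H), hadamard gen 9.  The prime `167` divides `668 = 4 · 167`, so the
transfer to the 2-(667,333,166) structure used for the other primes (which needs a fixed row) is not available, and `167` was
listed in the spectrum `{2,3,5,7,11,13,23,37,41,83,167}` (`hadamard668_signedAut_prime_mem'`) as 'not analysed'.  Here:
**`hadamard668_fixedRows_167` — a signed-permutation automorphism `(π, κ, d, e)` of a Hadamard matrix of order `668` with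
`π^167 = κ^167 = 1`, `(π, κ) ≠ (1, 1)` fixes NO row and NO column: both permutations have exactly `4` orbits of length `167`.**
So an H(668) with an automorphism of order 167 is of '4-orbit type' — the shape of the classical four-circulant-block families
(Williamson, Goethals–Seidel, propus: a `4 × 4` array of ±1 blocks of order 167 on which `Z₁₆₇` acts regularly), and its orbit
matrix in Hadamard form is a `4 × 4` odd-integer matrix `A` with `A Aᵀ = 668 I₄` (e.g. the quaternion matrix of `(25,5,3,3)`,
`25² + 5² + 3² + 3² = 668`), so the orbit-matrix level carries no obstruction for `167`.
Proof (no design theory).  Let `f` be the number of `κ`-fixed columns and `w` the number of `κ`-classes, `f + 167 w = 668`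
(`card_fixed_add_classes`), so `w ≤ 4` and `f = 668 − 167 w`.  For two `π`-fixed rows `u ≠ u'` the product `H u j · H u' j` is
constant along every `κ`-class (`fixedRows_prod_pow`, `fixedRows_sign_eq_odd`), hence (`fixedRows_split`)
`Σ_{κ j = j} H u j H u' j + 167 · Σ_C H u (rep C) H u' (rep C) = 0`.  If `w ≥ 1` then there are at most `4` fixed rows
(`hadamard668_fixedRows_le_four_167`): with five fixed rows `u₀,…,u₄` — `w = 4` (`f = 0`): the vectors
`(H uᵢ (rep C))_C ∈ {±1}⁴` are pairwise orthogonal, impossible for five vectors (`card_le_of_pairwise_orthogonal`, linear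
independence over `ℚ`); `w = 3` (`f = 167`): the fixed part `S` of the product of two of them is divisible by `167`, odd and
`|S| ≤ 167`, so `S = ±167` and the two rows agree up to sign on all fixed columns; then `(H uᵢ j⋆, (H uᵢ (rep C))_C) ∈ {±1}⁴`
(`j⋆` a fixed column) are pairwise orthogonal — impossible; `w = 2` (`f = 334`): among five rows three have the same 'parity'
`H u (rep C₁) H u (rep C₂)`, any two of those agree up to the sign `−H u (rep C₁) H u' (rep C₁)` on the fixed columns, and three
such signs are inconsistent; `w = 1` (`f = 501`): `S = −167 ψ_u ψ_u'` with `ψ_u = H u (rep C)`, and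
`0 ≤ Σ_{j fixed} (Σᵢ ψᵢ H uᵢ j)² = 5 · 501 − 20 · 167 < 0`.  Finally `w = 0` would mean `κ = 1`, hence `π = 1`
(`signedAut_snd_eq_one` for `Hᵀ`); so `w ≥ 1`, the number of fixed rows is `≤ 4` and `≡ 668 (mod 167)`, i.e. `0`; columns by
transposition.  Ours, not literature; no `sorry`; no `decide` beyond small numeric facts.
-/

open Finset BigOperators Matrix

namespace Summit.Ventures.DiscreteObjects.Hadamard

open Literature.Combinatorics.Designs.GoethalsSeidel (IsHadamardMatrix)

variable {ι : Type*} [Fintype ι] [DecidableEq ι]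

section order167

variable {H : Matrix ι ι ℤ} {π κ : Equiv.Perm ι} {d e : ι → ℤ}

/-- `167` is prime -/
private lemma p167 : Nat.Prime 167 := by norm_num
/-- `167` is odd -/
private lemma odd167 : Odd 167 := by decide

/-- the product of two entries is `±1` -/
private lemma entryProd_pm (hH : IsHadamardMatrix H) (i i' j j' : ι) : H i j * H i' j' = 1 ∨ H i j * H i' j' = -1 := by
  rcases hH.1 i j with h | h <;> rcases hH.1 i' j' with h' | h' <;> simp [h, h']

/-- **Case `w = 4` (no fixed column): five fixed rows are impossible.** -/
private lemma case_four (hH : IsHadamardMatrix H) (haut : IsSignedAut H π κ d e) (hκ : κ ^ 167 = 1)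
    (uu : Fin 5 → ι) (huu : Function.Injective uu) (hfix : ∀ i, π (uu i) = uu i)
    (rep : Finset ι → ι) (hrep : ∀ C ∈ blockClasses κ 167, rep C ∈ C)
    (hk : (blockClasses κ 167).card = 4) (hf : (univ.filter fun j => κ j = j).card = 0) : False := by
  have hempty : (univ.filter fun j => κ j = j) = ∅ := Finset.card_eq_zero.mp hf
  have hT : ∀ i i', i ≠ i' → ∑ C ∈ blockClasses κ 167, H (uu i) (rep C) * H (uu i') (rep C) = 0 := by
    intro i i' hii'
    have hs := fixedRows_split hH haut p167 odd167 hκ (hfix i) (hfix i') (huu.ne hii') rep hrep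
    rw [hempty, Finset.sum_empty, zero_add] at hs
    have : (167 : ℤ) ≠ 0 := by norm_num
    exact (mul_eq_zero.mp (by exact_mod_cast hs)).resolve_left this
  let v : Fin 5 → {C // C ∈ blockClasses κ 167} → ℚ := fun i C => (H (uu i) (rep C.1) : ℚ)
  have horth : ∀ i i', i ≠ i' → ∑ C, v i C * v i' C = 0 := by
    intro i i' hii'
    have h1 : ∑ C : {C // C ∈ blockClasses κ 167}, v i C * v i' C =
        ∑ C ∈ blockClasses κ 167, ((H (uu i) (rep C) * H (uu i') (rep C) : ℤ) : ℚ) := by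
      rw [← Finset.sum_coe_sort (blockClasses κ 167)]
      simp [v]
    rw [h1, ← Int.cast_sum, hT i i' hii', Int.cast_zero]
  obtain ⟨C₀, hC₀⟩ : (blockClasses κ 167).Nonempty := Finset.card_pos.mp (by rw [hk]; norm_num)
  have hnz : ∀ i, ∃ C, v i C ≠ 0 := by
    intro i
    refine ⟨⟨C₀, hC₀⟩, ?_⟩
    rcases hH.1 (uu i) (rep C₀) with h | h <;> simp [v, h]
  have hle := card_le_of_pairwise_orthogonal v hnz horth
  rw [Fintype.card_coe, hk] at hle
  omega

/-- **Case `w = 3` (`167` fixed columns): five fixed rows are impossible.** -/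
private lemma case_three (hH : IsHadamardMatrix H) (haut : IsSignedAut H π κ d e) (hκ : κ ^ 167 = 1)
    (uu : Fin 5 → ι) (huu : Function.Injective uu) (hfix : ∀ i, π (uu i) = uu i)
    (rep : Finset ι → ι) (hrep : ∀ C ∈ blockClasses κ 167, rep C ∈ C)
    (hk : (blockClasses κ 167).card = 3) (hf : (univ.filter fun j => κ j = j).card = 167) : False := by
  set Fc := (univ.filter fun j => κ j = j) with hFc
  -- for i ≠ i': T = Σ_C ... is ±1 and every fixed column has H (uu i) j * H (uu i') j = -T
  have key : ∀ i i', i ≠ i' →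
      (∑ C ∈ blockClasses κ 167, H (uu i) (rep C) * H (uu i') (rep C) = 1 ∨
       ∑ C ∈ blockClasses κ 167, H (uu i) (rep C) * H (uu i') (rep C) = -1) ∧
      ∀ j ∈ Fc, H (uu i) j * H (uu i') j = -∑ C ∈ blockClasses κ 167, H (uu i) (rep C) * H (uu i') (rep C) := by
    intro i i' hii'
    have hs := fixedRows_split hH haut p167 odd167 hκ (hfix i) (hfix i') (huu.ne hii') rep hrep
    have hpm : ∀ j ∈ Fc, H (uu i) j * H (uu i') j = 1 ∨ H (uu i) j * H (uu i') j = -1 :=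
      fun j _ => entryProd_pm hH _ _ _ _
    have habs := abs_sum_pm_le_card Fc (fun j => H (uu i) j * H (uu i') j) hpm
    have hpar := two_dvd_sum_pm_sub_card Fc (fun j => H (uu i) j * H (uu i') j) hpm
    rw [hf] at habs hpar
    obtain ⟨c, hc⟩ := hpar
    have hb := abs_le.mp habs
    set S := ∑ j ∈ Fc, H (uu i) j * H (uu i') j with hS
    set T := ∑ C ∈ blockClasses κ 167, H (uu i) (rep C) * H (uu i') (rep C) with hTdef
    push_cast at hs hb hc
    have hT : T = 1 ∨ T = -1 := by omega
    refine ⟨hT, ?_⟩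
    rcases hT with hT1 | hT1
    · -- S = -167: all terms -1
      have hSv : S = -(Fc.card : ℤ) := by rw [hf]; push_cast; omega
      intro j hj
      rw [hT1]
      exact pm_eq_neg_one_of_sum_eq_neg_card Fc _ hpm hSv j hj
    · have hSv : S = (Fc.card : ℤ) := by rw [hf]; push_cast; omega
      intro j hj
      rw [hT1]
      have := pm_eq_one_of_sum_eq_card Fc _ hpm hSv j hj
      simpa using this
  obtain ⟨jstar, hjstar⟩ : Fc.Nonempty := Finset.card_pos.mp (by rw [hf]; norm_num)
  let v : Fin 5 → Option {C // C ∈ blockClasses κ 167} → ℚ := fun i x =>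
    match x with
    | none => (H (uu i) jstar : ℚ)
    | some C => (H (uu i) (rep C.1) : ℚ)
  have horth : ∀ i i', i ≠ i' → ∑ x, v i x * v i' x = 0 := by
    intro i i' hii'
    obtain ⟨-, hcol⟩ := key i i' hii'
    have h0 := hcol jstar hjstar
    rw [Fintype.sum_option]
    have h1 : ∑ C : {C // C ∈ blockClasses κ 167}, v i (some C) * v i' (some C) =
        ((∑ C ∈ blockClasses κ 167, H (uu i) (rep C) * H (uu i') (rep C) : ℤ) : ℚ) := by
      rw [Int.cast_sum, ← Finset.sum_coe_sort (blockClasses κ 167)]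
      simp [v]
    rw [h1]
    have h2 : v i none * v i' none = ((H (uu i) jstar * H (uu i') jstar : ℤ) : ℚ) := by simp [v]
    rw [h2, h0]
    push_cast
    ring
  have hnz : ∀ i, ∃ x, v i x ≠ 0 := by
    intro i
    refine ⟨none, ?_⟩
    rcases hH.1 (uu i) jstar with h | h <;> simp [v, h]
  have hle := card_le_of_pairwise_orthogonal v hnz horth
  rw [Fintype.card_option, Fintype.card_coe, hk] at hle
  omega

/-- **Case `w = 2` (`334` fixed columns): five fixed rows are impossible.** -/
private lemma case_two (hH : IsHadamardMatrix H) (haut : IsSignedAut H π κ d e) (hκ : κ ^ 167 = 1)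
    (uu : Fin 5 → ι) (huu : Function.Injective uu) (hfix : ∀ i, π (uu i) = uu i)
    (rep : Finset ι → ι) (hrep : ∀ C ∈ blockClasses κ 167, rep C ∈ C)
    (hk : (blockClasses κ 167).card = 2) (hf : (univ.filter fun j => κ j = j).card = 334) : False := by
  set Fc := (univ.filter fun j => κ j = j) with hFc
  obtain ⟨C₁, C₂, hC12, hcls⟩ := Finset.card_eq_two.mp hk
  -- ψ-values and parities
  let ψ₁ : Fin 5 → ℤ := fun i => H (uu i) (rep C₁)
  let ψ₂ : Fin 5 → ℤ := fun i => H (uu i) (rep C₂)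
  let par : Fin 5 → ℤ := fun i => ψ₁ i * ψ₂ i
  have hψ₁ : ∀ i, ψ₁ i = 1 ∨ ψ₁ i = -1 := fun i => hH.1 _ _
  have hψ₂ : ∀ i, ψ₂ i = 1 ∨ ψ₂ i = -1 := fun i => hH.1 _ _
  have hpar : ∀ i ∈ (univ : Finset (Fin 5)), par i ∈ ({1, -1} : Finset ℤ) := by
    intro i _
    rcases hψ₁ i with h | h <;> rcases hψ₂ i with h' | h' <;> simp [par, h, h']
  -- rigidity for a pair with equal parity: every fixed column has H (uu a) j * H (uu b) j = -(ψ₁ a * ψ₁ b)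
  have rigid : ∀ a b, a ≠ b → par a = par b → ∀ j ∈ Fc, H (uu a) j * H (uu b) j = -(ψ₁ a * ψ₁ b) := by
    intro a b hab hpab
    have hs := fixedRows_split hH haut p167 odd167 hκ (hfix a) (hfix b) (huu.ne hab) rep hrep
    rw [hcls, Finset.sum_pair hC12] at hs
    have hpm : ∀ j ∈ Fc, H (uu a) j * H (uu b) j = 1 ∨ H (uu a) j * H (uu b) j = -1 :=
      fun j _ => entryProd_pm hH _ _ _ _
    -- ψ₂ a ψ₂ b = ψ₁ a ψ₁ b
    have h2 : ψ₂ a * ψ₂ b = ψ₁ a * ψ₁ b := by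
      have e1 : ψ₂ a = par a * ψ₁ a := by
        rcases hψ₁ a with h | h <;> simp [par, h]
      have e2 : ψ₂ b = par b * ψ₁ b := by
        rcases hψ₁ b with h | h <;> simp [par, h]
      rw [e1, e2, hpab]
      have : par b * par b = 1 := by rcases hψ₁ b with h | h <;> rcases hψ₂ b with h' | h' <;> simp [par, h, h']
      calc par b * ψ₁ a * (par b * ψ₁ b) = (par b * par b) * (ψ₁ a * ψ₁ b) := by ring
        _ = ψ₁ a * ψ₁ b := by rw [this, one_mul]
    set S := ∑ j ∈ Fc, H (uu a) j * H (uu b) j with hS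
    change S + (167 : ℕ) * (ψ₁ a * ψ₁ b + ψ₂ a * ψ₂ b) = 0 at hs
    rw [h2] at hs
    push_cast at hs
    rcases entryProd_pm hH (uu a) (uu b) (rep C₁) (rep C₁) with hτ | hτ
    · -- τ = 1 : S = -334
      have hτ' : ψ₁ a * ψ₁ b = 1 := hτ
      have hSv : S = -(Fc.card : ℤ) := by rw [hf]; push_cast; rw [hτ'] at hs; omega
      intro j hj
      rw [hτ']
      exact pm_eq_neg_one_of_sum_eq_neg_card Fc _ hpm hSv j hj
    · have hτ' : ψ₁ a * ψ₁ b = -1 := hτ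
      have hSv : S = (Fc.card : ℤ) := by rw [hf]; push_cast; rw [hτ'] at hs; omega
      intro j hj
      rw [hτ']
      have := pm_eq_one_of_sum_eq_card Fc _ hpm hSv j hj
      simpa using this
  -- pigeonhole: three rows with the same parity
  have hcardt : ({1, -1} : Finset ℤ).card * 2 < (univ : Finset (Fin 5)).card := by
    rw [Finset.card_univ, Fintype.card_fin]
    have : ({1, -1} : Finset ℤ).card ≤ 2 := Finset.card_le_two
    omega
  obtain ⟨y, -, hy⟩ := Finset.exists_lt_card_fiber_of_mul_lt_card_of_maps_to hpar hcardt
  obtain ⟨t3, ht3, ht3c⟩ := Finset.exists_subset_card_eq (show 3 ≤ (univ.filter fun i => par i = y).card by omega)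
  obtain ⟨x, yy, z, hxy, hxz, hyz, ht3eq⟩ := Finset.card_eq_three.mp ht3c
  have hmem : ∀ a ∈ t3, par a = y := fun a ha => (Finset.mem_filter.mp (ht3 ha)).2
  have hx : par x = y := hmem x (by rw [ht3eq]; simp)
  have hyy : par yy = y := hmem yy (by rw [ht3eq]; simp)
  have hz : par z = y := hmem z (by rw [ht3eq]; simp)
  obtain ⟨jstar, hjstar⟩ : Fc.Nonempty := Finset.card_pos.mp (by rw [hf]; norm_num)
  have e1 := rigid x yy hxy (by rw [hx, hyy]) jstar hjstar
  have e2 := rigid x z hxz (by rw [hx, hz]) jstar hjstar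
  have e3 := rigid yy z hyz (by rw [hyy, hz]) jstar hjstar
  -- six ±1 values with inconsistent products
  have gx := hH.1 (uu x) jstar
  have gy := hH.1 (uu yy) jstar
  have gz := hH.1 (uu z) jstar
  have qx := hψ₁ x
  have qy := hψ₁ yy
  have qz := hψ₁ z
  simp only [ψ₁] at e1 e2 e3 qx qy qz
  generalize H (uu x) jstar = a at e1 e2 gx
  generalize H (uu yy) jstar = b at e1 e3 gy
  generalize H (uu z) jstar = c at e2 e3 gz
  generalize H (uu x) (rep C₁) = a' at e1 e2 qx
  generalize H (uu yy) (rep C₁) = b' at e1 e3 qy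
  generalize H (uu z) (rep C₁) = c' at e2 e3 qz
  rcases gx with rfl | rfl <;> rcases gy with rfl | rfl <;> rcases gz with rfl | rfl <;>
    rcases qx with rfl | rfl <;> rcases qy with rfl | rfl <;> rcases qz with rfl | rfl <;> omega

/-- **Case `w = 1` (`501` fixed columns): five fixed rows are impossible.** -/
private lemma case_one (hH : IsHadamardMatrix H) (haut : IsSignedAut H π κ d e) (hκ : κ ^ 167 = 1)
    (uu : Fin 5 → ι) (huu : Function.Injective uu) (hfix : ∀ i, π (uu i) = uu i)
    (rep : Finset ι → ι) (hrep : ∀ C ∈ blockClasses κ 167, rep C ∈ C)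
    (hk : (blockClasses κ 167).card = 1) (hf : (univ.filter fun j => κ j = j).card = 501) : False := by
  set Fc := (univ.filter fun j => κ j = j) with hFc
  obtain ⟨C₁, hcls⟩ := Finset.card_eq_one.mp hk
  let ψ : Fin 5 → ℤ := fun i => H (uu i) (rep C₁)
  have hψ : ∀ i, ψ i * ψ i = 1 := fun i => pm_mul_self (hH.1 _ _)
  -- the inner products of the sign-adjusted fixed parts
  let c : Fin 5 → Fin 5 → ℤ := fun i i' => ∑ j ∈ Fc, (ψ i * H (uu i) j) * (ψ i' * H (uu i') j)
  have hc : ∀ i i', c i i' = if i = i' then 501 else -167 := by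
    intro i i'
    have hci : c i i' = ψ i * ψ i' * ∑ j ∈ Fc, H (uu i) j * H (uu i') j := by
      simp only [c, Finset.mul_sum]
      apply Finset.sum_congr rfl
      intro j _
      ring
    by_cases hii' : i = i'
    · subst hii'
      rw [if_pos rfl, hci, hψ i, one_mul]
      calc ∑ j ∈ Fc, H (uu i) j * H (uu i) j = ∑ j ∈ Fc, (1 : ℤ) :=
            Finset.sum_congr rfl (fun j _ => pm_mul_self (hH.1 _ _))
        _ = 501 := by rw [Finset.sum_const, nsmul_eq_mul, mul_one, hf]; norm_num
    · rw [if_neg hii', hci]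
      have hs := fixedRows_split hH haut p167 odd167 hκ (hfix i) (hfix i') (huu.ne hii') rep hrep
      rw [hcls, Finset.sum_singleton] at hs
      push_cast at hs
      have hS : ∑ j ∈ Fc, H (uu i) j * H (uu i') j = -167 * (ψ i * ψ i') := by
        simp only [ψ]; linarith
      rw [hS]
      calc ψ i * ψ i' * (-167 * (ψ i * ψ i')) = -167 * ((ψ i * ψ i) * (ψ i' * ψ i')) := by ring
        _ = -167 := by rw [hψ i, hψ i', mul_one, mul_one]
  -- the nonnegative quantity Σ_j (Σ_i ψ_i H (uu i) j)² = Σ_i Σ_i' c i i' = 5·501 − 20·167 < 0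
  have hQ : (0 : ℤ) ≤ ∑ j ∈ Fc, (∑ i, ψ i * H (uu i) j) * (∑ i, ψ i * H (uu i) j) :=
    Finset.sum_nonneg (fun j _ => mul_self_nonneg _)
  have hQ' : ∑ j ∈ Fc, (∑ i, ψ i * H (uu i) j) * (∑ i, ψ i * H (uu i) j) = ∑ i, ∑ i', c i i' := by
    simp only [c]
    simp_rw [Finset.sum_mul_sum]
    rw [Finset.sum_comm]
    apply Finset.sum_congr rfl
    intro i _
    rw [Finset.sum_comm]
  have hval : (∑ i : Fin 5, ∑ i' : Fin 5, (if i = i' then (501 : ℤ) else -167)) = -835 := by decide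
  rw [hQ'] at hQ
  simp only [hc] at hQ
  rw [hval] at hQ
  omega

/-- **At most four fixed rows** once `κ` has at least one class of moved columns (order 167). -/
theorem hadamard668_fixedRows_le_four_167 (hH : IsHadamardMatrix H) (hι : Fintype.card ι = 668)
    (haut : IsSignedAut H π κ d e) (hκ : κ ^ 167 = 1) (hw : 1 ≤ (blockClasses κ 167).card) :
    (univ.filter fun i => π i = i).card ≤ 4 := by
  by_contra hlt
  obtain ⟨t, ht, htc⟩ := Finset.exists_subset_card_eq (show 5 ≤ (univ.filter fun i => π i = i).card by omega)
  let eqv := Finset.equivFinOfCardEq htc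
  let uu : Fin 5 → ι := fun i => (eqv.symm i).1
  have huu : Function.Injective uu := by
    intro a b h
    exact eqv.symm.injective (Subtype.ext h)
  have hfix : ∀ i, π (uu i) = uu i := fun i => (Finset.mem_filter.mp (ht (eqv.symm i).2)).2
  have hne_cls : ∀ C ∈ blockClasses κ 167, C.Nonempty := fun C hC =>
    Finset.card_pos.mp (by rw [card_of_mem_blockClasses κ p167 hκ hC]; norm_num)
  let rep : Finset ι → ι := fun C => if h : C.Nonempty then h.choose else uu 0
  have hrep : ∀ C ∈ blockClasses κ 167, rep C ∈ C := by
    intro C hC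
    simp only [rep, dif_pos (hne_cls C hC)]
    exact (hne_cls C hC).choose_spec
  have hcount := card_fixed_add_classes κ p167 hκ
  rw [hι] at hcount
  have hk4 : (blockClasses κ 167).card ≤ 4 := by omega
  rcases Nat.lt_or_ge (blockClasses κ 167).card 3 with h3 | h3
  · rcases Nat.lt_or_ge (blockClasses κ 167).card 2 with h2 | h2
    · have hk : (blockClasses κ 167).card = 1 := by omega
      exact case_one hH haut hκ uu huu hfix rep hrep hk (by omega)
    · have hk : (blockClasses κ 167).card = 2 := by omega
      exact case_two hH haut hκ uu huu hfix rep hrep hk (by omega)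
  · rcases Nat.lt_or_ge (blockClasses κ 167).card 4 with h4 | h4
    · have hk : (blockClasses κ 167).card = 3 := by omega
      exact case_three hH haut hκ uu huu hfix rep hrep hk (by omega)
    · have hk : (blockClasses κ 167).card = 4 := by omega
      exact case_four hH haut hκ uu huu hfix rep hrep hk (by omega)

/-- **Order 167: no fixed rows, no fixed columns, `4 + 4` orbits.**  A signed-permutation automorphism `(π, κ, d, e)` of a
Hadamard matrix of order `668` with `π^167 = κ^167 = 1` and `(π, κ) ≠ (1, 1)` fixes no row and no column; `π` and `κ` each have
exactly four orbits (classes) of length `167`. -/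
theorem hadamard668_fixedRows_167 (hH : IsHadamardMatrix H) (hι : Fintype.card ι = 668)
    (π κ : Equiv.Perm ι) (d e : ι → ℤ) (haut : IsSignedAut H π κ d e)
    (hπ : π ^ 167 = 1) (hκ : κ ^ 167 = 1) (hne : π ≠ 1 ∨ κ ≠ 1) :
    (univ.filter fun i => π i = i).card = 0 ∧ (univ.filter fun j => κ j = j).card = 0 ∧
    (blockClasses π 167).card = 4 ∧ (blockClasses κ 167).card = 4 := by
  have hcard : (Fintype.card ι : ℤ) ≠ 0 := by rw [hι]; norm_num
  have hT : IsHadamardMatrix Hᵀ := isHadamard_transpose hH hcard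
  have hautT : IsSignedAut Hᵀ κ π e d := by
    obtain ⟨hd, he, h⟩ := haut
    refine ⟨he, hd, fun j i => ?_⟩
    rw [Matrix.transpose_apply, Matrix.transpose_apply, h i j]; ring
  have hcκ := card_fixed_add_classes κ p167 hκ
  have hcπ := card_fixed_add_classes π p167 hπ
  rw [hι] at hcκ hcπ
  -- κ has at least one class: otherwise κ = 1 and then π = 1
  have hwκ : 1 ≤ (blockClasses κ 167).card := by
    by_contra h0
    have hf : (univ.filter fun j => κ j = j).card = 668 := by omega
    have hall : (univ.filter fun j => κ j = j) = univ :=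
      Finset.eq_univ_of_card _ (by rw [hf, hι])
    have hκ1 : κ = 1 := by
      ext j
      have := (Finset.mem_filter.mp (hall ▸ Finset.mem_univ j)).2
      simpa using this
    have hπ1 : π = 1 := by
      rw [hκ1] at hautT
      exact signedAut_snd_eq_one Hᵀ hT hcard hautT odd167 hπ
    rcases hne with h | h
    · exact h hπ1
    · exact h hκ1
  have hwπ : 1 ≤ (blockClasses π 167).card := by
    by_contra h0
    have hf : (univ.filter fun i => π i = i).card = 668 := by omega
    have hall : (univ.filter fun i => π i = i) = univ :=
      Finset.eq_univ_of_card _ (by rw [hf, hι])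
    have hπ1 : π = 1 := by
      ext i
      have := (Finset.mem_filter.mp (hall ▸ Finset.mem_univ i)).2
      simpa using this
    have hκ1 : κ = 1 := by
      rw [hπ1] at haut
      exact signedAut_snd_eq_one H hH hcard haut odd167 hκ
    rcases hne with h | h
    · exact h hπ1
    · exact h hκ1
  have h4r := hadamard668_fixedRows_le_four_167 hH hι haut hκ hwκ
  have h4c := hadamard668_fixedRows_le_four_167 hT hι hautT hπ hwπ
  refine ⟨by omega, by omega, by omega, by omega⟩

end order167

end Summit.Ventures.DiscreteObjects.Hadamard
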